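import Mathlib
import Summits.Ventures.PercRepro2.SwOutCrossGenSumJointQ

/-!
# Two cross components as one fibre with the mark in the first: the inequality of the glued fibre
(blind cell PercRepro2, night-4 g27, 2026-08-28; proofs/NIGHT4-G27.md §2)

The cube of the glued fibre `fibKEEQSum` over the u-arms `ι` is the cube of the joint product
`F₁.prodL (fibKEEBit G₂ hG₂) (jointKEQ …)` read through the gluing, exactly as g25's
`SwOutCrossGenSumIneq` read `fibKEESum`: the points correspond by `glueKE` / `splitKE`, the atoms
by `aMap`, the leak, the type (the SAME joint link label on both sides) and the red and blue
atoms correspond.  Hence **`ineq_fibKEEQSum`**: the inequality of `ineq_prodL` holds for the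
glued fibre with the link fields of the mark `Sum.inl q` — the abstract input of Theorem A_cross
with the mark at a dropped vertex for a first fibre with the link fields and a further connected
cross component; since `fibKEEQSum` has the link fields again, it iterates
(`SwOutCrossJunctionQSwGN`).
-/

namespace Summit.Ventures.PercRepro2

namespace CrossArm

open Classical

section Transport

variable {X₁ X₂ : Type*} {G₁ : SimpleGraph X₁} (G₂ : SimpleGraph X₂) [Fintype X₂] [DecidableEq X₂]
  [DecidableRel G₂.Adj] [Nonempty X₂] (hG₂ : G₂.Connected) (q : X₁)
  (F₁ : FibreIter (FibKE X₁ G₁) (AtomKEE X₁ G₁) (LabelKEQ X₁))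
  (hflip : F₁.flip = FibKE.flip) (hleak : F₁.leakR = leakKE G₁)
  (hlab : F₁.label = labelKEQ G₁ q) (hB : F₁.BetterL = BetterKEQ) (hred : F₁.red = redKEE G₁)
  {ι : Type*}

include hflip hleak hlab hB hred

/-- The leak of the glued cube is the leak of the joint product cube. -/
lemma leakI_sumQ_iff (s : Config ι) (w₁ : FibKE X₁ G₁) (w₂ : FibKE X₂ G₂) :
    LeakI (fibKEEQSum G₂ q F₁ hflip hleak hlab hB hred) (s, glueKE G₁ G₂ w₁ w₂) ↔
      LeakI (F₁.prodL (fibKEEBit G₂ hG₂) (jointKEQ G₂ hG₂ q F₁ hflip hleak hlab hB))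
        (s, (w₁, w₂)) := by
  show (redUG s ∧ leakKE (G₁ ⊕g G₂) (glueKE G₁ G₂ w₁ w₂) = true) ∨
      (blueUG s ∧ leakKE (G₁ ⊕g G₂) (glueKE G₁ G₂ w₁ w₂).flip = true) ↔
    (redUG s ∧ (F₁.leakR w₁ || leakKE G₂ w₂) = true) ∨
      (blueUG s ∧ (F₁.leakR (F₁.flip w₁) || leakKE G₂ w₂.flip) = true)
  rw [← glueKE_flip, leakKE_glue, leakKE_glue, hleak, hflip]

/-- The red atoms of the glued cube, atom by atom through `aMap`. -/
lemma mem_ERI_sumQ_iff (s : Config ι) (w₁ : FibKE X₁ G₁) (w₂ : FibKE X₂ G₂)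
    (b : AtomG (AtomKEE X₁ G₁ ⊕ AtomKEE X₂ G₂) ι) :
    aMap G₁ G₂ ι b ∈ ERI (fibKEEQSum G₂ q F₁ hflip hleak hlab hB hred) (s, glueKE G₁ G₂ w₁ w₂) ↔
      b ∈ ERI (F₁.prodL (fibKEEBit G₂ hG₂) (jointKEQ G₂ hG₂ q F₁ hflip hleak hlab hB))
        (s, (w₁, w₂)) := by
  rcases b with j | (u | ((i | t) | (i | t)))
  · exact Iff.rfl
  · exact Iff.rfl
  · show redUG s ∧ redKEE (G₁ ⊕g G₂) (glueKE G₁ G₂ w₁ w₂) (Sum.inl (Sum.inl i)) = true ↔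
      redUG s ∧ F₁.red w₁ (Sum.inl i) = true
    rw [redKEE_glue_inl, hred]
  · show redUG s ∧ redKEE (G₁ ⊕g G₂) (glueKE G₁ G₂ w₁ w₂)
        (Sum.inr ((SimpleGraph.edgeSetSumEquiv (G := G₁) (H := G₂)).symm (Sum.inl t))) = true ↔
      redUG s ∧ F₁.red w₁ (Sum.inr t) = true
    rw [redKEE_glue_edge_inl, hred]
  · show redUG s ∧ redKEE (G₁ ⊕g G₂) (glueKE G₁ G₂ w₁ w₂) (Sum.inl (Sum.inr i)) = true ↔
      redUG s ∧ redKEE G₂ w₂ (Sum.inl i) = true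
    rw [redKEE_glue_inr]
  · show redUG s ∧ redKEE (G₁ ⊕g G₂) (glueKE G₁ G₂ w₁ w₂)
        (Sum.inr ((SimpleGraph.edgeSetSumEquiv (G := G₁) (H := G₂)).symm (Sum.inr t))) = true ↔
      redUG s ∧ redKEE G₂ w₂ (Sum.inr t) = true
    rw [redKEE_glue_edge_inr]

/-- The red atoms of the glued cube are the image of those of the joint product cube. -/
lemma ERI_sumQ_eq (s : Config ι) (w₁ : FibKE X₁ G₁) (w₂ : FibKE X₂ G₂) :
    ERI (fibKEEQSum G₂ q F₁ hflip hleak hlab hB hred) (s, glueKE G₁ G₂ w₁ w₂) =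
      aMap G₁ G₂ ι ''
        ERI (F₁.prodL (fibKEEBit G₂ hG₂) (jointKEQ G₂ hG₂ q F₁ hflip hleak hlab hB))
          (s, (w₁, w₂)) := by
  ext a
  constructor
  · intro ha
    obtain ⟨b, rfl⟩ := aMap_surjective G₁ G₂ ι a
    exact ⟨b, (mem_ERI_sumQ_iff G₂ hG₂ q F₁ hflip hleak hlab hB hred s w₁ w₂ b).1 ha, rfl⟩
  · rintro ⟨b, hb, rfl⟩
    exact (mem_ERI_sumQ_iff G₂ hG₂ q F₁ hflip hleak hlab hB hred s w₁ w₂ b).2 hb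

/-- The blue atoms of the glued cube are the image of those of the joint product cube. -/
lemma EBI_sumQ_eq (s : Config ι) (w₁ : FibKE X₁ G₁) (w₂ : FibKE X₂ G₂) :
    EBI (fibKEEQSum G₂ q F₁ hflip hleak hlab hB hred) (s, glueKE G₁ G₂ w₁ w₂) =
      aMap G₁ G₂ ι ''
        EBI (F₁.prodL (fibKEEBit G₂ hG₂) (jointKEQ G₂ hG₂ q F₁ hflip hleak hlab hB))
          (s, (w₁, w₂)) := by
  show ERI (fibKEEQSum G₂ q F₁ hflip hleak hlab hB hred) (flipAll s, (glueKE G₁ G₂ w₁ w₂).flip) =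
    aMap G₁ G₂ ι '' ERI (F₁.prodL (fibKEEBit G₂ hG₂) (jointKEQ G₂ hG₂ q F₁ hflip hleak hlab hB))
      (flipAll s, (F₁.flip w₁, w₂.flip))
  rw [hflip, ← glueKE_flip]
  exact ERI_sumQ_eq G₂ hG₂ q F₁ hflip hleak hlab hB hred (flipAll s) w₁.flip w₂.flip

variable [Fintype ι] [DecidableEq ι] [Fintype X₁] [DecidableEq X₁] [DecidableRel G₁.Adj] [Nonempty ι]

omit [Nonempty ι] in
/-- A point of the glued cube is in `QI` iff its split is in `QI` of the joint product cube. -/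
lemma mem_QI_sumQ_iff (𝒯 : Set (TypG (LabelKEQ (X₁ ⊕ X₂)) ι)) (s : Config ι) (w₁ : FibKE X₁ G₁)
    (w₂ : FibKE X₂ G₂) :
    (s, glueKE G₁ G₂ w₁ w₂) ∈ QI (fibKEEQSum G₂ q F₁ hflip hleak hlab hB hred) 𝒯 ↔
      (s, (w₁, w₂)) ∈
        QI (F₁.prodL (fibKEEBit G₂ hG₂) (jointKEQ G₂ hG₂ q F₁ hflip hleak hlab hB)) 𝒯 := by
  rw [mem_QI, mem_QI, leakI_sumQ_iff G₂ hG₂]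
  exact Iff.rfl

include hG₂ in
/-- **THE INEQUALITY OF THE GLUED FIBRE WITH THE MARK IN THE FIRST PART**: the abstract input of
Theorem A_cross with the mark at a dropped vertex, for a first fibre with the link fields of the
mark and a further connected cross component, with the joint link order, on the fibre of the
disjoint-union graph. -/
theorem ineq_fibKEEQSum (hineq : Ineq F₁ (ι := ι)) :
    Ineq (fibKEEQSum G₂ q F₁ hflip hleak hlab hB hred) (ι := ι) := by
  intro 𝒯 𝓔 h𝒯 h𝓔
  set S := fibKEEQSum G₂ q F₁ hflip hleak hlab hB hred with hS
  set P := F₁.prodL (fibKEEBit G₂ hG₂) (jointKEQ G₂ hG₂ q F₁ hflip hleak hlab hB) with hP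
  let 𝓔' : Set (Set (AtomG (AtomKEE X₁ G₁ ⊕ AtomKEE X₂ G₂) ι)) := {T | aMap G₁ G₂ ι '' T ∈ 𝓔}
  have h𝓔' : IsUpperSet 𝓔' := fun T T' hTT' hT => h𝓔 (Set.image_mono hTT') hT
  have h𝒯' : IsUpI P 𝒯 := fun t ht t' hle => h𝒯 t ht t' hle
  have key := ineq_prodL (jointKEQ G₂ hG₂ q F₁ hflip hleak hlab hB) hineq 𝒯 𝓔' h𝒯' h𝓔'
  have e1 : ((QI S 𝒯).filter fun q => ERI S q ∈ 𝓔).card =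
      ((QI P 𝒯).filter fun x => ERI P x ∈ 𝓔').card := by
    refine Finset.card_bij' (fun q _ => (q.1, splitKE G₁ G₂ q.2))
      (fun x _ => (x.1, glueKE G₁ G₂ x.2.1 x.2.2)) ?_ ?_ ?_ ?_
    · intro q hq
      rw [Finset.mem_filter] at hq ⊢
      obtain ⟨hQ, hE⟩ := hq
      have hq' : q = (q.1, glueKE G₁ G₂ (splitKE G₁ G₂ q.2).1 (splitKE G₁ G₂ q.2).2) := by
        rw [glueKE_splitKE]
      rw [hq', mem_QI_sumQ_iff G₂ hG₂] at hQ
      rw [hq', ERI_sumQ_eq G₂ hG₂] at hE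
      exact ⟨hQ, hE⟩
    · intro x hx
      rw [Finset.mem_filter] at hx ⊢
      obtain ⟨hQ, hE⟩ := hx
      rw [mem_QI_sumQ_iff G₂ hG₂]
      refine ⟨hQ, ?_⟩
      rw [ERI_sumQ_eq G₂ hG₂]
      exact hE
    · intro q _
      show (q.1, glueKE G₁ G₂ (splitKE G₁ G₂ q.2).1 (splitKE G₁ G₂ q.2).2) = q
      rw [glueKE_splitKE]
    · intro x _
      show (x.1, splitKE G₁ G₂ (glueKE G₁ G₂ x.2.1 x.2.2)) = x
      rw [splitKE_glueKE]
  have e2 : ((QI S 𝒯).filter fun q => EBI S q ∈ 𝓔).card =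
      ((QI P 𝒯).filter fun x => EBI P x ∈ 𝓔').card := by
    refine Finset.card_bij' (fun q _ => (q.1, splitKE G₁ G₂ q.2))
      (fun x _ => (x.1, glueKE G₁ G₂ x.2.1 x.2.2)) ?_ ?_ ?_ ?_
    · intro q hq
      rw [Finset.mem_filter] at hq ⊢
      obtain ⟨hQ, hE⟩ := hq
      have hq' : q = (q.1, glueKE G₁ G₂ (splitKE G₁ G₂ q.2).1 (splitKE G₁ G₂ q.2).2) := by
        rw [glueKE_splitKE]
      rw [hq', mem_QI_sumQ_iff G₂ hG₂] at hQ
      rw [hq', EBI_sumQ_eq G₂ hG₂] at hE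
      exact ⟨hQ, hE⟩
    · intro x hx
      rw [Finset.mem_filter] at hx ⊢
      obtain ⟨hQ, hE⟩ := hx
      rw [mem_QI_sumQ_iff G₂ hG₂]
      refine ⟨hQ, ?_⟩
      rw [EBI_sumQ_eq G₂ hG₂]
      exact hE
    · intro q _
      show (q.1, glueKE G₁ G₂ (splitKE G₁ G₂ q.2).1 (splitKE G₁ G₂ q.2).2) = q
      rw [glueKE_splitKE]
    · intro x _
      show (x.1, splitKE G₁ G₂ (glueKE G₁ G₂ x.2.1 x.2.2)) = x
      rw [splitKE_glueKE]
  rw [e1, e2]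
  exact key

end Transport

section Instance

variable {X₁ X₂ : Type*} (G₁ : SimpleGraph X₁) (G₂ : SimpleGraph X₂)
  [Fintype X₁] [DecidableEq X₁] [DecidableRel G₁.Adj] [Nonempty X₁] (hG₁ : G₁.Connected)
  [Fintype X₂] [DecidableEq X₂] [DecidableRel G₂.Adj] [Nonempty X₂] (hG₂ : G₂.Connected) (q : X₁)

/-- **The glued fibre of two connected cross components with the mark `q` in the first.** -/
noncomputable def fibKEEQSum₂ :
    FibreIter (FibKE (X₁ ⊕ X₂) (G₁ ⊕g G₂)) (AtomKEE (X₁ ⊕ X₂) (G₁ ⊕g G₂)) (LabelKEQ (X₁ ⊕ X₂)) :=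
  fibKEEQSum G₂ q (FibreIter.ofBit (fibKEEQBit G₁ hG₁ q)) rfl rfl rfl rfl rfl

variable {ι : Type*} [Fintype ι] [DecidableEq ι] [Nonempty ι]

include hG₂ in
/-- **The abstract inequality for two connected cross components at one junction with the mark
at a dropped vertex of the first**, with the joint link order, on the fibre of the disjoint-union
graph. -/
theorem ineq_fibKEEQSum₂ : Ineq (fibKEEQSum₂ G₁ G₂ hG₁ q) (ι := ι) :=
  ineq_fibKEEQSum G₂ hG₂ q (FibreIter.ofBit (fibKEEQBit G₁ hG₁ q)) rfl rfl rfl rfl rfl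
    (ineq_ofBit (fibKEEQBit G₁ hG₁ q))

include hG₁ hG₂ in
/-- The record of the disjoint union of two connected components with the mark in the first has
the inequality (the joint link order). -/
theorem ineqM_fibKEEQSum₂ : IneqM (fibKEEQMin (G₁ ⊕g G₂) (Sum.inl q)) (ι := ι) :=
  ineqM_of_ineq (fibKEEQSum₂ G₁ G₂ hG₁ q) (ineq_fibKEEQSum₂ G₁ G₂ hG₁ hG₂ q)

end Instance

end CrossArm

end Summit.Ventures.PercRepro2
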